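import Literature.NumberTheory.EllipticCurves.FormalGroupFiniteHeightProofs
import HarnessLib

/-!
# `[2](z) = 2z − a₁z² + ⋯`: the quadratic coefficient of the duplication series, over every
# commutative ring (proofs only)

Topic `NumberTheory/EllipticCurves` (theorems only; no definition, no named fact). Silverman,
*AEC* IV.2.3: `[2](z) = 2z − a₁z² − 2a₂z³ + (a₁a₂ − 7a₃)z⁴ + ⋯`. The tree has `[n](z) = nz + O(z²)`
(`coeff_one_formalMul'`); this file adds the next coefficient of `[2]`:

* `coeff_one_formalInvDiff : [z¹] ω = a₁` (from `[z¹] η = −a₁`, private copy of the tree's lemma)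
  (`ω = 1/η = 1 + a₁z + ⋯`, Silverman IV.1);
* `coeff_two_formalMul_two : [z²] [2] = −a₁` over every commutative ring — from the invariance of
  `ω` under `[2]` over any ring (`formalInvDiff_subst_formalMul_mul_derivative'`:
  `ω([2]z)·[2]'(z) = 2ω(z)`) read in degree `1`: `2c₂ + 4a₁ = 2a₁`, first over the universal ring
  `ℤ[a₁,…,a₆]` (torsion-free) and then by specialisation.

Use (finite-height route to Edixhoven's integrality at `p = 2`, `NeronIsogenyScaling.lean`): on a
semistable model `V''` over `𝒪_K` at `2` this is the coefficient `b₂ = −a₁''` of `[2]_{V''}` whose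
norm `‖a₁''‖ = 2^{−v₂(j)/12}` (good model, `v₂(j) ≤ 8`) resp. `1` (ordinary or nodal model) feeds
the slope hypothesis of `ManinConstantSemistableTwistWildProofs` with `i = 2`.

## References

* J. H. Silverman, *The Arithmetic of Elliptic Curves*, 2nd ed. (2009), IV.1 (expansion of `ω`),
  IV.2.3 (`[2](z) = 2z − a₁z² − ⋯`). [SilvermanAEC2009]
-/

noncomputable section

open PowerSeries Literature.NumberTheory.EllipticCurves

namespace WeierstrassCurve

variable {R : Type*} [CommRing R] (W : WeierstrassCurve R)

/-- `[z¹] η = −a₁` (`η = 1 − (a₁z + a₂z² + 2a₃w + 2a₄zw + 3a₆w²)`, `w = O(z³)`); a private copy of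
the tree's `WeierstrassCurve.coeff_one_formalEta` (`PadicSigmaIsogenyCriterionProofs`, not imported
here to keep this file light). [cite: SilvermanAEC2009, IV.1.1] -/
private theorem coeff_one_formalEta' : coeff 1 W.formalEta = -W.a₁ := by
  obtain ⟨B, hB⟩ : (X : R⟦X⟧) ^ 3 ∣ W.formalW :=
    X_pow_dvd_iff.mpr fun m hm ↦ W.coeff_formalW_of_lt_three hm
  have e : W.formalEta = 1 - C W.a₁ * X - X ^ 2 *
      (C W.a₂ + 2 * C W.a₃ * X * B + 2 * C W.a₄ * X ^ 2 * B + 3 * C W.a₆ * X ^ 4 * B ^ 2) := by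
    rw [formalEta_def, hB]; ring
  rw [e, map_sub, map_sub, coeff_one, if_neg one_ne_zero, coeff_C_mul, coeff_one_X, mul_one,
    coeff_X_pow_mul', if_neg (by norm_num)]
  ring

/-- `[z¹] ω = a₁` (`ω = 1/η = 1 + a₁z + (a₁² + a₂)z² + ⋯`, Silverman IV.1). [cite: SilvermanAEC2009, IV.1.1] -/
theorem coeff_one_formalInvDiff : coeff 1 W.formalInvDiff = W.a₁ := by
  have h := congrArg (coeff 1) W.formalEta_mul_formalInvDiff
  rw [PowerSeries.coeff_one_mul, W.constantCoeff_formalEta, W.constantCoeff_formalInvDiff,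
    coeff_one_formalEta', coeff_one, if_neg one_ne_zero] at h
  linear_combination h

/-- **`[z²] [2](z) = −a₁` over every commutative ring** (Silverman IV.2.3:
`[2](z) = 2z − a₁z² − 2a₂z³ + ⋯`): from `ω([2]z)·[2]'(z) = 2ω(z)` in degree `1`,
`2c₂ + 4a₁ = 2a₁`, over the universal ring and by specialisation.
[cite: SilvermanAEC2009, IV.2.3] -/
theorem coeff_two_formalMul_two : coeff 2 (W.formalMul 2) = -W.a₁ := by
  -- the universal case: `2 c₂ = -2 a₁` in the torsion-free ring `ℤ[a₁,…,a₆]`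
  have hZ : coeff 2 (universalInt.formalMul 2) = -universalInt.a₁ := by
    set U := universalInt with hU
    have key := U.formalInvDiff_subst_formalMul_mul_derivative' 2
    have hD0 : constantCoeff (U.formalMul 2) = 0 := U.constantCoeff_formalMul 2
    have hD1 : coeff 1 (U.formalMul 2) = 2 := by rw [U.coeff_one_formalMul']; norm_num
    set D := U.formalMul 2 with hDdef
    have hA0 : constantCoeff (U.formalInvDiff.subst D) = 1 := by
      rw [constantCoeff_subst_eq_constantCoeff hD0, U.constantCoeff_formalInvDiff]
    have hA1 : coeff 1 (U.formalInvDiff.subst D) = U.a₁ * 2 := by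
      rw [coeff_one_subst_eq_mul _ hD0, coeff_one_formalInvDiff, hD1]
    have hB0 : constantCoeff (d⁄dX (MvPolynomial (Fin 5) ℤ) D) = 2 := by
      rw [← coeff_zero_eq_constantCoeff_apply, PowerSeries.coeff_derivative, zero_add, hD1]
      simp
    have hB1 : coeff 1 (d⁄dX (MvPolynomial (Fin 5) ℤ) D) = coeff 2 D * 2 := by
      rw [PowerSeries.coeff_derivative]
      norm_num
    have hR1 : coeff 1 ((2 : ℕ) • U.formalInvDiff) = 2 * U.a₁ := by
      rw [map_nsmul, coeff_one_formalInvDiff, nsmul_eq_mul, Nat.cast_ofNat]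
    have h := congrArg (coeff 1) key
    rw [PowerSeries.coeff_one_mul, hA0, hA1, hB0, hB1, hR1] at h
    -- h : U.a₁ * 2 * 2 + coeff 2 D * 2 * 1 = 2 * U.a₁
    have h' : (2 : MvPolynomial (Fin 5) ℤ) * (coeff 2 D + U.a₁) = 0 := by linear_combination h
    have h2 : (2 : MvPolynomial (Fin 5) ℤ) ≠ 0 := by exact_mod_cast (two_ne_zero : (2 : ℤ) ≠ 0)
    have := (mul_eq_zero.mp h').resolve_left h2
    linear_combination this
  -- specialise
  have hR := congrArg W.universalEval hZ
  rw [← coeff_map, map_formalMul, universalInt_map, map_neg] at hR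
  rw [hR]
  have := congrArg WeierstrassCurve.a₁ W.universalInt_map
  rw [map_a₁] at this
  rw [this]

end WeierstrassCurve
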